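import Literature.NumberTheory.EllipticCurves.PAdicBSDKatoFiniteProofs
import Literature.NumberTheory.EllipticCurves.LFunctionSmulProofs
import Literature.NumberTheory.EllipticCurves.QuadraticTwistSelmerPInfty
import Literature.NumberTheory.EllipticCurves.MinimalModelReduction
import Literature.NumberTheory.EllipticCurves.GlobalMinimalModelProofs
import HarnessLib

/-!
# bsd.S20 (`kato_finite_of_L_one_ne_zero`) is independent of the chosen Weierstrass equation

Companion proof file of `Literature.NumberTheory.EllipticCurves.PAdicBSD` (theorems only; no
definition, no named fact, no instance, no `sorry`). It records that Kato's finiteness fact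
bsd.S20 `kato_finite_of_L_one_ne_zero W p` — "`L(E, 1) ≠ 0 ⇒ E(ℚ)`, `Ш(E/ℚ)[p^∞]` and
`Sel_{p^∞}(E/ℚ)` are finite" (Kato, Astérisque 295 (2004), Thm. 14.2 (2) / Cor. 14.3, p. 235) — is a
statement about the elliptic curve `E/ℚ`, not about the Weierstrass equation `W` chosen for it:

* `kato_finite_of_L_one_ne_zero_smul_iff`: for every admissible change of variables `C` over `ℚ`,
  `kato_finite_of_L_one_ne_zero (C • W) p ↔ kato_finite_of_L_one_ne_zero W p`. Every ingredient of
  the fact is an isomorphism invariant ALREADY IN THE TREE: the entire `L`-function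
  (`WeierstrassCurve.entireLFunction_smul`: Mathlib's `WeierstrassCurve.LFunction` is the Euler
  product of the local factors computed on LOCAL MINIMAL MODELS, so no junk value enters at a
  non-minimal equation), the Mordell–Weil group (`WeierstrassCurve.Affine.Point.nonempty_smul_equiv`,
  Silverman *AEC* III.1) and `Ш[p^∞]` (`WeierstrassCurve.shaEquiv`, additive because it is the
  restriction of `galH1Equiv`, with `primaryComponentCongr`; Silverman *AEC* X.§4); the Selmer clause
  is equivalent to the other two (`kato_finite_of_L_one_ne_zero_iff`, Greenberg LNM 1716 §1).
* `forall_kato_finite_of_L_one_ne_zero_iff_forall_isGloballyMinimal`: consequently the binder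
  `∀ (W : WeierstrassCurve ℚ) [W.IsElliptic], kato_finite_of_L_one_ne_zero W p` used by several
  Summits-side certificates is EQUIVALENT to its restriction to globally minimal equations
  `∀ (W) [W.IsElliptic] [W.IsGloballyMinimal], kato_finite_of_L_one_ne_zero W p` (every elliptic
  equation over `ℚ` has a global minimal model `C • W`, `WeierstrassCurve.hasGlobalMinimalModel_rat_holds`,
  Silverman *AEC* Cor. VIII.8.3); `forall_kato_finite_of_L_one_ne_zero_of_forall_isGloballyMinimal`
  is the direction consumers need.

Motivation (cell `pub/bsd-wall`, R-128 junk-dependence census, route pen TP2/RTT 2026-08-29): the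
hypothesis `hS20 : ∀ (W : WeierstrassCurve ℚ) [W.IsElliptic], kato_finite_of_L_one_ne_zero W 2` of
`Summit…SignedKatoOffTwo.KatoBK.signedKatoDivisibilityUpToAtTwo_of_kato2004_cor143_facts` (and of
consumers in other routes) quantifies over non-minimal equations; this file shows that nothing is
lost or gained by doing so. Nothing here proves bsd.S20 itself (a named fact, Kato Cor. 14.3); BSD is
not advanced by this file.

## References

* K. Kato, *p-adic Hodge theory and values of zeta functions of modular forms*, Astérisque 295
  (2004), Thm. 14.2 (2) and Cor. 14.3 (p. 235). [Kato2004Asterisque]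
* J. H. Silverman, *The Arithmetic of Elliptic Curves*, GTM 106, 2nd ed. (2009): III.1 (admissible
  changes of variables), Prop. VII.1.3 (b), Cor. VIII.8.3 (global minimal models over `ℚ`), X.§4
  (`Ш`), App. C §16 (the `L`-series). [SilvermanAEC2009]
* R. Greenberg, *Iwasawa theory for elliptic curves*, LNM 1716 (1999), §1 pp. 54–57. [Greenberg1999LNM]
-/

noncomputable section

open scoped Classical

namespace Literature.NumberTheory.EllipticCurves

open WeierstrassCurve

variable (W : WeierstrassCurve ℚ) [W.IsElliptic] (C : VariableChange ℚ) (p : ℕ) [Fact p.Prime]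

/-- **bsd.S20 is invariant under admissible changes of variables**: for an elliptic Weierstrass
equation `W` over `ℚ`, an admissible change of variables `C` and a prime `p`,
`kato_finite_of_L_one_ne_zero (C • W) p ↔ kato_finite_of_L_one_ne_zero W p` — `L(C • W, s) = L(W, s)`
(`entireLFunction_smul`), `(C • W)(ℚ) ≃ W(ℚ)` (`Affine.Point.nonempty_smul_equiv`),
`Ш(C • W)[p^∞] ≃ Ш(W)[p^∞]` (`shaEquiv`, additive, with `primaryComponentCongr`), and the Selmer
clause follows from the other two on both sides (`kato_finite_of_L_one_ne_zero_iff`).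
[cite: Kato2004Asterisque, Thm. 14.2 (2) and Cor. 14.3 (p. 235)]
[cite: SilvermanAEC2009, III.1, X.§4 and App. C §16] -/
theorem kato_finite_of_L_one_ne_zero_smul_iff :
    kato_finite_of_L_one_ne_zero (C • W) p ↔ kato_finite_of_L_one_ne_zero W p := by
  rw [kato_finite_of_L_one_ne_zero_iff, kato_finite_of_L_one_ne_zero_iff, entireLFunction_smul]
  have hpt : Finite (C • W).toAffine.Point ↔ Finite W.toAffine.Point :=
    Equiv.finite_iff (Affine.Point.nonempty_smul_equiv C W).some
  have e : W.sha ≃+ (C • W).sha :=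
    { shaEquiv W C with
      map_add' := fun a b ↦
        Subtype.ext (map_add (galH1Equiv W C) (a : W.galH1) (b : W.galH1)) }
  have hsha : Finite (AddCommGroup.primaryComponent (C • W).sha p) ↔
      Finite (AddCommGroup.primaryComponent W.sha p) :=
    (Equiv.finite_iff (primaryComponentCongr e p).toEquiv).symm
  rw [hpt, hsha]

omit [W.IsElliptic] C in
/-- **The two universal closures of bsd.S20 agree**: for a prime `p`,
`(∀ W elliptic over ℚ, kato_finite_of_L_one_ne_zero W p) ↔ (∀ W elliptic AND GLOBALLY MINIMAL,
kato_finite_of_L_one_ne_zero W p)`. The nontrivial direction moves an arbitrary elliptic equation to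
a global minimal model `C • W` (`hasGlobalMinimalModel_rat_holds`, Silverman *AEC* Cor. VIII.8.3 —
`ℤ` is a principal ideal domain) and transports the fact back along
`kato_finite_of_L_one_ne_zero_smul_iff`. [cite: SilvermanAEC2009, Cor. VIII.8.3 (p. 213)]
[cite: Kato2004Asterisque, Cor. 14.3 (p. 235)] -/
theorem forall_kato_finite_of_L_one_ne_zero_iff_forall_isGloballyMinimal :
    (∀ (W : WeierstrassCurve ℚ) [W.IsElliptic], kato_finite_of_L_one_ne_zero W p) ↔
      ∀ (W : WeierstrassCurve ℚ) [W.IsElliptic] [W.IsGloballyMinimal],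
        kato_finite_of_L_one_ne_zero W p := by
  refine ⟨fun h W _ _ ↦ h W, fun h W _ ↦ ?_⟩
  obtain ⟨C, hC⟩ := hasGlobalMinimalModel_rat_holds W
  exact (kato_finite_of_L_one_ne_zero_smul_iff W C p).mp (h (C • W))

omit [W.IsElliptic] C in
/-- **Consumers' direction**: bsd.S20 for every globally minimal elliptic equation over `ℚ` gives
bsd.S20 for every elliptic equation over `ℚ` (the binder shape
`∀ (W : WeierstrassCurve ℚ) [W.IsElliptic], kato_finite_of_L_one_ne_zero W p` used Summits-side).
[cite: SilvermanAEC2009, Cor. VIII.8.3 (p. 213)] [cite: Kato2004Asterisque, Cor. 14.3 (p. 235)] -/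
theorem forall_kato_finite_of_L_one_ne_zero_of_forall_isGloballyMinimal
    (h : ∀ (W : WeierstrassCurve ℚ) [W.IsElliptic] [W.IsGloballyMinimal],
      kato_finite_of_L_one_ne_zero W p)
    (W : WeierstrassCurve ℚ) [W.IsElliptic] : kato_finite_of_L_one_ne_zero W p :=
  (forall_kato_finite_of_L_one_ne_zero_iff_forall_isGloballyMinimal p).mpr
    (fun W _ _ ↦ h W) W

end Literature.NumberTheory.EllipticCurves

end
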